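import Summits.HodgeConjecture.HodgeConjecture.Theorems.Ring2Hypotheses
import Summits.HodgeConjecture.HodgeConjecture.Theorems.Ring2HypothesesCMPivot
import Summits.HodgeConjecture.HodgeConjecture.Theorems.Ring2DeformCMPivotAnchors
import Summits.HodgeConjecture.HodgeConjecture.Theorems.Ring2BindersAbelianSchemeVHCLocal
import Literature.AlgebraicGeometry.Motives.AbelianFibresOfAbelianFibre
import Literature.AlgebraicGeometry.HodgeTheory.IsoTransport
import HarnessLib

/-!
# Ring 2 — binder seat b02 (Hodge ladder stage 3): row b02 `AbelianSchemeVHC` DOMINATES row b08 `LocalVHCAtCM`,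
# and the CM pivot is EXACT — both modulo Catanese's theorem (c21) alone

HONEST FRAMING: research route conditional on HC_CM; not a corollary; Q11.4-sentence-2 already refuted in dim ≥ 3.

Cell `pub-hodge-ring2`, Hodge ladder stage 3, binder seat `ring2-b02` (row b02 of `BINDER-OWNERS.md`: the named
hypothesis `Ring2.Hypotheses.AbelianSchemeVHC`, `Theorems/Ring2Hypotheses.lean` — Grothendieck's variational Hodge
conjecture along smooth projective families all of whose fibres are abelian varieties; OPEN). Row b08 is
`Ring2.Hypotheses.LocalVHCAtCM` (`Theorems/Ring2HypothesesCMPivot.lean` — the same conjecture as a GERM at a CM fibre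
of a smooth projective family over a quasi-projective base; OPEN; the one row of the dictionary on which `HC_CM` is
load-bearing). Nothing in this file proves a case of the Hodge conjecture; `HC_CM` is the route item
`Theses.RankFourFaces.CMAbelianHodge` BY NAME and appears below only as a conjunct of a conclusion or as the
hypothesis of the CM pivot it already is in the dictionary — never restated, never cited.

## What is proved (sorry-free; the only Literature named fact consumed is c21
## `Motives.catanese2002_abelianFibres_of_abelianFibre`, displayed as a hypothesis)

A typing point first. Row b08 quantifies over smooth projective families `f : 𝒳 ⟶ S` with ONE fibre presented as a
(CM) abelian variety `A₀ ≅ 𝒳_{s₀}`, and its Hodge clause `HodgeAlong` constrains the global class `G` only on fibres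
PRESENTED as abelian varieties. So neither row b02 (which wants every fibre abelian) nor even `HC_AV` or the summit
statement reaches row b08 in the kernel without knowing that the other fibres are abelian varieties — which is
Catanese's theorem (deformations in the large of complex tori are complex tori), the tree's refereed named fact c21,
exactly on row b08's carriers (quasi-projective total space and base, smooth irreducible base). Granted c21:

* §1 (per instance, fact-free) `map_fiberι_mem_algebraicClasses_of_abelianFibres_of_abelianSchemeVHC`: along a smooth
  projective family over a smooth irreducible base ALL of whose complex fibres are abelian varieties, a global class
  that is rational `(p,p)` on every abelian presentation of a fibre and algebraic on one fibre is algebraic on every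
  fibre — row b02 read in row b08's `FibreIncl`/`HodgeAlong` typing (iso-transport of rationality, Hodge type and
  dimension).
* §2 **`AbelianSchemeVHC ∧ c21 ⟹ LocalVHCAtCM`** (`localVHCAtCM_of_abelianSchemeVHC_of_catanese2002`), with
  `U = S(ℂ)`; the CM hypothesis `IsCM[A₀]` and the quasi-projectivity clauses are IDLE except as inputs of c21. This
  FACTORS seat b06's (K4) `localVHCAtCM_of_absoluteHodgeImpliesAlgebraicAV_of_principleB_of_catanese` (row b06 ⟹
  row b08 modulo c21, c22, c23) through its (K3) (row b06 ⟹ row b02 modulo c22, c23).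
* §3 the ON-PATH lemmas row b08 did not have: `HC_AV ∧ c21 ⟹ LocalVHCAtCM` and `HodgeConjecture ∧ c21 ⟹
  LocalVHCAtCM` (the CM-pivot file's `localVHCAtCM_of_hodgeAbelianVarieties` takes "all fibres abelian" as an inline
  hypothesis; here it is the named fact).
* §4 **EXACTNESS OF THE CM PIVOT**: granted `CMAnchoredFamilies` (row b07, CITE, kernel-bound to Deligne 1982
  Prop. 6.1) and c21, `HC_AV ↔ HC_CM ∧ LocalVHCAtCM`, and the item-16267 form `CMToAbelian ↔ (HC_CM → LocalVHCAtCM)`;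
  with row b07 supplied by the refereed fact `Deligne1982.deligne1982_cmDenseMumfordTateFamilies`. So the pivot
  `HC_CM ∧ b07 ∧ b08 ⟹ HC_AV` loses nothing: modulo print, row b08 is precisely what `HC_CM` must be supplemented by.

References: [Grothendieck1966] footnote 13; [CharlesSchnell2014Notes] Conj. 11.3.1, Cor. 11.3.6, proof of
Prop. 11.3.11, Thm. 11.5.11; [Deligne1982HodgeCycles] Prop. 6.1, Milne's 2003 re-edition endnote 19;
[Catanese2002DeformationTypes] §4 Thm. 4.1 and Thm. 4.6; [MumfordGIT] Ch. 6 §3 Thm. 6.14.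
-/

-- every declaration of this problem lives in `Summit.HodgeConjecture.HodgeConjecture.…` (summit = sub-problem);
-- namespace `…Ring2.Binders` = the binder seats of the cell's Hodge-ladder stage 3 (`BINDER-OWNERS.md`)
set_option linter.dupNamespace false

noncomputable section

open CategoryTheory AlgebraicGeometry
open Literature.AlgebraicGeometry Literature.AlgebraicGeometry.Motives
open Literature.AlgebraicGeometry.HodgeTheory
open Literature.AlgebraicGeometry.Deligne1982 (deligne1982_cmDenseMumfordTateFamilies)

namespace Summit.HodgeConjecture.HodgeConjecture.Ring2.Binders

open Summit.HodgeConjecture.HodgeConjecture.Ring2.Hypotheses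

/-! ## §1 Row b02 in row b08's typing, per instance (fact-free) -/

/-- **Row b02 along a family all of whose complex fibres are abelian varieties, in the `FibreIncl`/`HodgeAlong`
typing of the CM pivot.** For `f : 𝒳 ⟶ S` smooth projective of relative dimension `m` over a smooth irreducible
`S`, every complex fibre `𝒳_t ≅ B.X` for some abelian variety `B`, and a global class `G ∈ H²ᵖ(𝒳(ℂ);ℂ)` which is
rational `(p,p)` on every abelian presentation `eB = i ≫ ι_u : B.X ⟶ 𝒳` of a fibre: if `G|_{𝒳_{s₀}}` is algebraic
then `G|_{𝒳_t}` is algebraic for every `t`. Row b02 `AbelianSchemeVHC` applies once its fibrewise clause is read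
off the presentations: rationality and Hodge type move along `i : B.X ≅ 𝒳_u`
(`isRationalClass_map_iff_of_iso`, `isOfHodgeType_map_iff_of_iso`) and `dim B = m` (`dim_eq_of_iso_fiberOver`).
[cite: CharlesSchnell2014Notes, Conj. 11.3.1] [cite: Deligne1982HodgeCycles, Milne 2003 re-edition endnote 19] -/
theorem map_fiberι_mem_algebraicClasses_of_abelianFibres_of_abelianSchemeVHC (hV : AbelianSchemeVHC)
    {m : ℕ} {𝒳 S : SchemeOver ℂ} (f : 𝒳 ⟶ S) (hf : IsSmoothProjectiveFamily f m)
    (hirr : IrreducibleSpace S.left) (hsm : AlgebraicGeometry.Smooth S.hom)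
    (hab : ∀ t : ComplexPoints S, ∃ B : AbelianVariety ℂ, Nonempty (B.X ≅ fiberOver f t))
    (p : ℕ) (G : complexBetti 𝒳 (2 * p))
    (hG : ∀ (B : AbelianVariety ℂ) (eB : B.X ⟶ 𝒳) (u : ComplexPoints S),
      (∃ i : B.X ≅ fiberOver f u, eB = i.hom ≫ fiberι f u) →
        IsRationalClass (complexBetti.map eB (2 * p) G) ∧
          IsOfHodgeType B.dim B.X (2 * p) p p (complexBetti.map eB (2 * p) G))
    {s₀ : ComplexPoints S}
    (h₀ : complexBetti.map (fiberι f s₀) (2 * p) G ∈ algebraicClasses (fiberOver f s₀) p)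
    (t : ComplexPoints S) :
    complexBetti.map (fiberι f t) (2 * p) G ∈ algebraicClasses (fiberOver f t) p := by
  refine hV f hf hirr hsm ((abelianFibres_iff_of_isSmoothProjectiveFamily hf).2 hab) p G (fun s => ?_)
    ⟨s₀, h₀⟩ t
  obtain ⟨B, ⟨i⟩⟩ := hab s
  have h := hG B (i.hom ≫ fiberι f s) s ⟨i, rfl⟩
  have he : complexBetti.map (i.hom ≫ fiberι f s) (2 * p) G =
      complexBetti.map i.hom (2 * p) (complexBetti.map (fiberι f s) (2 * p) G) := by
    rw [complexBetti.map_comp]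
    rfl
  rw [he] at h
  have hdim : B.dim = m := dim_eq_of_iso_fiberOver hf i
  refine ⟨(isRationalClass_map_iff_of_iso i).1 h.1, ?_⟩
  rw [← hdim]
  exact (isOfHodgeType_map_iff_of_iso i).1 h.2

/-! ## §2 Row b02 ⟹ row b08, modulo Catanese's theorem (c21) -/

/-- **`AbelianSchemeVHC ∧ c21 ⟹ LocalVHCAtCM` (row b02 ⟹ row b08), no `HC_CM`.** In row b08's own typing (smooth
projective `f : 𝒳 ⟶ S` of relative dimension `m`, `𝒳` and `S` quasi-projective, `S` smooth irreducible, a CM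
abelian fibre `A₀ ≅ 𝒳_{s₀}` on which the global class `G` is ALGEBRAIC, `G` rational `(p,p)` on every fibre
presented as an abelian variety) the conclusion holds with `U = S(ℂ)`: the anchor is moved to THE fibre `𝒳_{s₀}`
along the chart (`mem_algebraicClasses_map_iff_of_iso`), every complex fibre is an abelian variety by Catanese's
theorem (`Motives.catanese2002_abelianFibres_of_abelianFibre`, fed with `dim A₀ = m`), and §1 applies. The CM
hypothesis `IsCM[A₀]` is IDLE (any algebraically anchored fibre does), as are the quasi-projectivity clauses beyond
their use as inputs of c21. Factors seat b06's (K4) through its (K3).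
[cite: CharlesSchnell2014Notes, Conj. 11.3.1] [cite: Catanese2002DeformationTypes, §4 Thm. 4.1 and Thm. 4.6]
[cite: Deligne1982HodgeCycles, Prop. 6.1 and Milne 2003 re-edition endnote 19] -/
theorem localVHCAtCM_of_abelianSchemeVHC_of_catanese2002 (hC : catanese2002_abelianFibres_of_abelianFibre)
    (hV : AbelianSchemeVHC) : LocalVHCAtCM := by
  intro S 𝒳 f m p G s₀ A₀ e₀ h𝒳 hS hsm hirr hf hA₀ _ halg hG
  obtain ⟨i, hi⟩ := hA₀
  -- the anchor `A₀ ≅ 𝒳_{s₀}`: algebraic on THE fibre `𝒳_{s₀}`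
  have he₀ : complexBetti.map e₀ (2 * p) G =
      complexBetti.map i.hom (2 * p) (complexBetti.map (fiberι f s₀) (2 * p) G) := by
    rw [hi, complexBetti.map_comp]
    rfl
  rw [he₀] at halg
  have halg₀ : complexBetti.map (fiberι f s₀) (2 * p) G ∈ algebraicClasses (fiberOver f s₀) p :=
    (mem_algebraicClasses_map_iff_of_iso i).1 halg
  -- every fibre is an abelian variety (Catanese), the family having relative dimension `dim A₀ = m`
  have hdim : A₀.dim = m := dim_eq_of_iso_fiberOver hf i
  have hfam : IsSmoothProjectiveFamily f A₀.dim := hdim ▸ hf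
  have hab : ∀ t : ComplexPoints S, ∃ B : AbelianVariety ℂ, Nonempty (B.X ≅ fiberOver f t) := fun t => by
    obtain ⟨B, -, hBt⟩ := hC f A₀ h𝒳 hS hirr hsm hfam ⟨s₀, ⟨i⟩⟩ t
    exact ⟨B, hBt⟩
  exact ⟨Set.univ, isOpen_univ, Set.mem_univ _, fun t _ =>
    map_fiberι_mem_algebraicClasses_of_abelianFibres_of_abelianSchemeVHC hV f hf hirr hsm hab p G hG halg₀ t⟩

/-! ## §3 On-path lemmas for row b08 (modulo c21): `HC_AV` and the summit give `LocalVHCAtCM` -/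

/-- **ON-PATH for row b08: `HC_AV ∧ c21 ⟹ LocalVHCAtCM`** — through row b02 (`abelianSchemeVHC_of_hc_av`,
Charles–Schnell Cor. 11.3.6, fact-free) and §2. The CM-pivot file's `localVHCAtCM_of_hodgeAbelianVarieties` is the
same arrow with "every fibre is presented by an abelian variety" as an inline hypothesis; here that clause is the
named fact c21. [cite: CharlesSchnell2014Notes, Cor. 11.3.6] [cite: Catanese2002DeformationTypes, §4 Thm. 4.1 and Thm. 4.6] -/
theorem localVHCAtCM_of_hc_av_of_catanese2002 (hC : catanese2002_abelianFibres_of_abelianFibre)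
    (h : Theses.PadicSemiregularLift.HodgeAbelianVarieties) : LocalVHCAtCM :=
  localVHCAtCM_of_abelianSchemeVHC_of_catanese2002 hC (abelianSchemeVHC_of_hc_av h)

/-- **ON-PATH for row b08: the summit statement and c21 give `LocalVHCAtCM`.** [cite: CharlesSchnell2014Notes, Cor. 11.3.6]
[cite: Catanese2002DeformationTypes, §4 Thm. 4.1 and Thm. 4.6] -/
theorem localVHCAtCM_of_hodgeConjecture_of_catanese2002 (hC : catanese2002_abelianFibres_of_abelianFibre)
    (h : _root_.HodgeConjecture) : LocalVHCAtCM :=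
  localVHCAtCM_of_abelianSchemeVHC_of_catanese2002 hC (abelianSchemeVHC_of_hodgeConjecture h)

/-! ## §4 Exactness of the CM pivot, modulo row b07 and c21 -/

/-- **EXACTNESS OF THE CM PIVOT: granted `CMAnchoredFamilies` (row b07) and c21, `HC_AV ↔ HC_CM ∧ LocalVHCAtCM`.**
(→) `HC_CM` is an instance of `HC_AV` (`hc_av_iff_hc_cm_and_cmToAbelian`) and row b08 follows by §3; (←) is the
dictionary's CM pivot `hc_av_of_hc_cm_of_cmAnchoredFamilies_of_localVHCAtCM` (Deligne's architecture: CM anchors +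
transport of algebraicity along the base). `HC_CM` = `Theses.RankFourFaces.CMAbelianHodge` BY NAME, a conjunct of one
side; nothing about it is decided. [cite: Deligne1982HodgeCycles, Prop. 6.1] [cite: CharlesSchnell2014Notes, Cor. 11.3.6 and proof of Prop. 11.3.11]
[cite: Catanese2002DeformationTypes, §4 Thm. 4.1 and Thm. 4.6] -/
theorem hc_av_iff_hc_cm_and_localVHCAtCM_of_cmAnchoredFamilies_of_catanese2002
    (hC : catanese2002_abelianFibres_of_abelianFibre) (hMT : CMAnchoredFamilies) :
    Theses.PadicSemiregularLift.HodgeAbelianVarieties ↔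
      Theses.RankFourFaces.CMAbelianHodge ∧ LocalVHCAtCM :=
  ⟨fun h => ⟨(hc_av_iff_hc_cm_and_cmToAbelian.1 h).1, localVHCAtCM_of_hc_av_of_catanese2002 hC h⟩,
    fun h => hc_av_of_hc_cm_of_cmAnchoredFamilies_of_localVHCAtCM h.1 hMT h.2⟩

/-- **Item-16267 form of the exactness: granted row b07 and c21, `CMToAbelian ↔ (HC_CM → LocalVHCAtCM)`** — the crux
item `Theses.RankFourFaces.CMToAbelian` (stmt-HodgeConjecture-16267, "`HC_CM ⟹ HC` for all abelian varieties") IS,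
modulo print, the statement that `HC_CM` forces the CM-germ variational Hodge statement. (→) from `HC_CM` and the item,
`HC_AV` (`hc_av_iff_hc_cm_and_cmToAbelian`), then §3; (←) from `HC_CM`, row b08, then the CM pivot gives `HC_AV`,
whose instances are the item's conclusion. [cite: Deligne1982HodgeCycles, Prop. 6.1]
[cite: CharlesSchnell2014Notes, Cor. 11.3.6 and proof of Prop. 11.3.11] [cite: Catanese2002DeformationTypes, §4 Thm. 4.1 and Thm. 4.6] -/
theorem cmToAbelian_iff_localVHCAtCM_of_hc_cm_of_cmAnchoredFamilies_of_catanese2002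
    (hC : catanese2002_abelianFibres_of_abelianFibre) (hMT : CMAnchoredFamilies) :
    Theses.RankFourFaces.CMToAbelian ↔ (Theses.RankFourFaces.CMAbelianHodge → LocalVHCAtCM) :=
  ⟨fun hT hCM => localVHCAtCM_of_hc_av_of_catanese2002 hC (hc_av_iff_hc_cm_and_cmToAbelian.2 ⟨hCM, hT⟩),
    fun h hCM A _ => hc_av_of_hc_cm_of_cmAnchoredFamilies_of_localVHCAtCM hCM hMT (h hCM) A⟩

/-- **The exactness with row b07 supplied by print**: granted Deligne 1982 Prop. 6.1 in the dense form of
Charles–Schnell Thm. 11.5.11 (the refereed fact `Deligne1982.deligne1982_cmDenseMumfordTateFamilies`, which gives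
`CMAnchoredFamilies` by the deform seat's `Ring2.Deform.cmAnchoredFamilies_of_deligne1982`) and c21,
`HC_AV ↔ HC_CM ∧ LocalVHCAtCM`. [cite: Deligne1982HodgeCycles, Prop. 6.1] [cite: CharlesSchnell2014Notes, Thm. 11.5.11]
[cite: Catanese2002DeformationTypes, §4 Thm. 4.1 and Thm. 4.6] -/
theorem hc_av_iff_hc_cm_and_localVHCAtCM_of_deligne1982_of_catanese2002
    (hD : deligne1982_cmDenseMumfordTateFamilies) (hC : catanese2002_abelianFibres_of_abelianFibre) :
    Theses.PadicSemiregularLift.HodgeAbelianVarieties ↔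
      Theses.RankFourFaces.CMAbelianHodge ∧ LocalVHCAtCM :=
  hc_av_iff_hc_cm_and_localVHCAtCM_of_cmAnchoredFamilies_of_catanese2002 hC
    (Ring2.Deform.cmAnchoredFamilies_of_deligne1982 hD)

/-- Item-16267 form with row b07 supplied by print: `CMToAbelian ↔ (HC_CM → LocalVHCAtCM)` granted Deligne 1982
Prop. 6.1 (dense form) and c21. [cite: Deligne1982HodgeCycles, Prop. 6.1] [cite: CharlesSchnell2014Notes, Thm. 11.5.11]
[cite: Catanese2002DeformationTypes, §4 Thm. 4.1 and Thm. 4.6] -/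
theorem cmToAbelian_iff_localVHCAtCM_of_hc_cm_of_deligne1982_of_catanese2002
    (hD : deligne1982_cmDenseMumfordTateFamilies) (hC : catanese2002_abelianFibres_of_abelianFibre) :
    Theses.RankFourFaces.CMToAbelian ↔ (Theses.RankFourFaces.CMAbelianHodge → LocalVHCAtCM) :=
  cmToAbelian_iff_localVHCAtCM_of_hc_cm_of_cmAnchoredFamilies_of_catanese2002 hC
    (Ring2.Deform.cmAnchoredFamilies_of_deligne1982 hD)

/-! ## Audit

`#print axioms` of every theorem above: `propext`, `Classical.choice`, `Quot.sound` (checked at submission). No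
`sorry`, no new `def`/`axiom`/`opaque`. Literature named facts consumed as hypotheses: c21
`Motives.catanese2002_abelianFibres_of_abelianFibre` (§2–§4) and, in the two `_of_deligne1982_` corollaries,
`Deligne1982.deligne1982_cmDenseMumfordTateFamilies`; open rows consumed as hypotheses: b02 `AbelianSchemeVHC` (§1–§2),
b07 `CMAnchoredFamilies` (§4); `HC_AV`, `HC_CM`, b08 and item 16267 appear as conclusions or as sides of an `↔`.
-/

end Summit.HodgeConjecture.HodgeConjecture.Ring2.Binders

end
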